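import Summits.BirchSwinnertonDyer.Rank1Residual.GaloisImage.KuriharaRecordBSDpThreeLevelOneEndNoRank
import Summits.BirchSwinnertonDyer.Rank1Residual.GaloisImage.KuriharaRecordBSDpThreeLevelTwoEndNoEP
import HarnessLib

/-!
# END-m1 record corollaries WITHOUT the `hEP` binder: Tate's local Euler–Poincaré characteristic
# formula is a THEOREM of the tree (cell `b2b-bsdres`, team n1011, seat p03 GEN 9, OWNERS row T-R1-57-REC
# record-side tool; lead R5-75 (b)(i) consumer rule; twins of p03's
# `GaloisImage/KuriharaRecordBSDpThreeLevelOneEndNoRank.lean` (p298696) fed by n1011-p04's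
# `GaloisImage/EPCTateFormula.lean` (p300886) through n1011-p18's by-name discharge
# `Assembly.localEulerPoincareCharacteristic_rat` (`GaloisImage/KuriharaRecordBSDpThreeLevelTwoEndNoEP.lean`))

HONEST FRAMING (cell `b2b-bsdres`, run/shared/lean/b2b/bsd-rank1-residual/, verbatim in every
file): the goal of the cell is to DELETE the COMBINATION-SHAPED residual classes of the
Birch–Swinnerton-Dyer formula for ALL analytic-rank `≤ 1` elliptic curves over `ℚ` — "full BSD
formula for every rank `≤ 1` curve in class `C`" assembled STRICTLY from published theorems — so
that the rank-`≤ 1` remainder becomes exactly the CONSTRUCTION-SHAPED classes, which are TYPED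
(missing-input `Prop`s), NOT attempted. This is not "finishing BSD". Team n1011 (N10/N11, the
additive block `X4 ∧ p = 3`): research route; PER-PAIR record SHAPE, NOT a class theorem; TOOL
theorems only (no definition, no named fact); nothing booked; no mark / label moved; the shapes
below CLOSE NOTHING.  END-m1 is DEBT REDUCTION, not coverage.

## What and why

Every END-m1 record corollary of the Kurihara lane carries the binder
`hEP : ∀ v : HeightOneSpectrum (𝓞 ℚ), localEulerPoincareCharacteristic (v.adicCompletion ℚ)` — Tate's
local Euler–Poincaré characteristic formula (Milne, *ADT* I Thm. 2.8; Serre, *CG* II §5.7 Thm. 5) at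
every finite place of `ℚ`, consumed on the LOWER side by the Selmer-structure bookkeeping behind
`exists_ne_zero_mem_selmerGroup_three_of_port_of_kolyvaginProduct_of_baseRigidity`.  Since n1011-p04's
`EPCTate.localEulerPoincareCharacteristic (F)` (p300886, `GaloisImage/EPCTateFormula.lean`) the named
fact's statement is a THEOREM for every non-archimedean local field of characteristic `0`, in
particular for each `v.adicCompletion ℚ`.  Per the n1011 lead's consumer rule (R5-75 (b)(i): "every
n1011 file that carries `(hEP : localEulerPoincareCharacteristic K)` MAY discharge it by
`EPCTate.localEulerPoincareCharacteristic K` … by the consumer's OWN append, one theorem per END")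
this file states p03's four `…_noRank` ENDs (the [S24]-free `…_of_baseRigidity_noRank` pair and the
NAMED-FACTS `…_of_facts_noRank` pair) WITHOUT `hEP` (suffix `_noEP`, the cell's convention — p16 p301705, p18's
`…LevelTwoEndNoEP`; every other binder unchanged and in the same order) and proves each by feeding
`hEP := localEulerPoincareCharacteristic_rat` (n1011-p18's packaging of
`fun v => EPCTate.localEulerPoincareCharacteristic (v.adicCompletion ℚ)` with the `CharZero (v.adicCompletion ℚ)`
instance supplied — the tree's `Prop` does not carry `[CharZero F]`, p04's theorem does) to the
`_noRank` theorem — a hypothesis DISCHARGED BY A THEOREM, not relabelled; ONE road for the discharge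
term (p18's, by name).  A sibling file `<File>EPC.lean` rather than an append: the 400-line cap (lead
R5-75 ADD 3).  Binder diff against p298696 = {`hEP`} exactly.  Effect on any END-m1
record instantiating these forms: the pass-through binder `hEP` disappears; on the `_of_facts_noRank_noEP`
forms every non-certificate hypothesis of a record is a NAMED FACT (`hKatoS hDel hGZK hmod hmodD hKatoχ
h26 hCT hPT`), the PORT `hPort`, or one of the per-pair EVIDENCE binders {`D`/`hopt`, the three
Kurihara VALUES}.  Nothing else changes; nothing is booked; no class closes.

References: J. S. Milne, *Arithmetic Duality Theorems* (2006) I §2 Thm. 2.8 [MilneADT2006];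
J.-P. Serre, *Galois Cohomology* (1997) II §5.7 Thm. 5 [SerreGaloisCohomology1997];
C.-H. Kim, AJM 148 (2026) §1.4.3, Thm. 1.9 (6), Thm. 3.13 [Kim2022StructureSelmer];
B. Mazur, J. Tate, J. Teitelbaum, Invent. Math. 84 (1986) §I.8 (8.6) [MazurTateTeitelbaum1986Invent];
K. Rubin, PCMI 18 (2011) Thm. 2.8.4 [Rubin2011]; K. Kato, Astérisque 295 (2004) Thm. 14.5 (3)
[Kato2004Asterisque]; D. Delbourgo (1998) Prop. 4 [Delbourgo1998]; Agashe–Ribet–Stein (2006) Thm. 2.6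
[AgasheRibetStein2006]; cell files cells/n1011/PLAN.md R5-75 (b), OWNERS.md (T-R1-57-REC, T-EPC).
-/

noncomputable section

open scoped Classical NumberField ContRepresentation
open Function Field NumberField IsDedekindDomain IsDedekindDomain.HeightOneSpectrum WeierstrassCurve
  CongruenceSubgroup
  Literature.NumberTheory.EllipticCurves Literature.NumberTheory.EllipticCurves.ModularForms
  Literature.NumberTheory.EllipticCurves.Rank1Residual
  Literature.NumberTheory.EllipticCurves.AgasheRibetStein2006
  Literature.NumberTheory.GaloisRepresentations
  Literature.NumberTheory.GaloisRepresentations.DiscreteGaloisModule Literature.NumberTheory.GaloisCohomology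
  Rat.HeightOneSpectrum
  Summit.BirchSwinnertonDyer.Rank1Residual.Additive Summit.BirchSwinnertonDyer.Rank1Residual.X4

namespace Summit.BirchSwinnertonDyer.Rank1Residual.GaloisImage.Assembly

/-- **END-m1 RECORD COROLLARY, [S24]-FREE, no `hr`, no `hEP` (potentially GOOD rows / tower form).**
Exactly p03's `bsdp_three_of_towerSurj_of_levelOneCertificates_of_baseRigidity_noRank` with the binder
`hEP : ∀ v, localEulerPoincareCharacteristic (v.adicCompletion ℚ)` DELETED — hEP discharged by p300886
(`EPCTate.localEulerPoincareCharacteristic`, Tate's local Euler–Poincaré characteristic formula, a theorem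
of the tree, fed by name as p18's `localEulerPoincareCharacteristic_rat`); all other binders unchanged and
in the same order.  CLOSES NOTHING; the Kurihara values stay EVIDENCE hypotheses; nothing booked.
[cite: MilneADT2006, I §2 Thm 2.8 (p. 31)]
[cite: Kim2022StructureSelmer, §1.4.3 (PDF p. 7), Thm. 1.9 (6) and Thm. 3.13] [cite: Rubin2011, Thm. 2.8.4]
[cite: Kato2004Asterisque, Thm. 14.5 (3) (p. 236)] [cite: AgasheRibetStein2006, Thm. 2.6 (p. 619)] -/
theorem bsdp_three_of_towerSurj_of_levelOneCertificates_of_baseRigidity_noRank_noEP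
    (hKatoS : Kato2004.rankZero_padicValNat_sha_le_sub_localTamagawa_of_additive_potGood_of_imageContainsSL2)
    (hDel : Delbourgo1998.prop4_rankZero_pow_dvd_constantCoeff)
    (hGZK : rank_eq_analyticRank_of_analyticRank_le_one) (hmod : hasEntireLFunction_rat)
    (hmodD : nonempty_modularParametrizationData)
    (hKatoχ : Wuthrich2014.kato_halfEigenCharIdeal_dvd_cyclotomicPrime_of_surjective)
    (h26 : cremona_abs_maninConstant_eq_one_of_level_le)
    (hCT : exists_casselsTate_pairing (K := ℚ))
    (W : WeierstrassCurve ℚ) [W.IsElliptic] [W.IsGloballyMinimal]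
    {E₀ : WeierstrassCurve ℤ} (hI : integralModelInt W = E₀)
    (hΔ : (3 : ℤ) ∣ E₀.Δ) (hc₄ : (3 : ℤ) ∣ E₀.c₄)
    (htower : ∀ m : ℕ, W.HasSurjectiveModNGaloisRep (3 ^ m : ℕ))
    (ht0 : Nat.card {Q : (W.baseChange ℚ_[3]).toAffine.Point // (3 : ℕ) • Q = 0} = 1)
    (htam : ¬ 3 ∣ W.tamagawaProduct)
    {N : ℕ} [NeZero N] (hN : N ≤ 130000) (D : ModularParametrizationData W N)
    (hopt : ∀ z ∈ D.L.lattice, ∃ w ∈ periodLattice D.f, z = D.c * w)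
    (inv : LocalInvariants ℚ 3) (hperf : inv.IsPerfect) (hsum : inv.SumLocalTermEqZero)
    (hcompl : inv.SelmerComplement)
    (v₃ : HeightOneSpectrum (𝓞 ℚ)) (hv₃ : ((3 : ℕ) : 𝓞 ℚ) ∈ v₃.asIdeal)
    (hPort : KatoKuriharaPortThreeAt W 0 v₃)
    (n : ℕ) [NeZero n] (hn : Kato.IsKolyvaginProduct W 3 1 n)
    (hcyc : ∀ (ℓ : ℕ) [Fact ℓ.Prime], ℓ ∣ n →
      Nat.card {P : ((integralModelInt W).map (Int.castRingHom (ZMod ℓ))).toAffine.Point //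
        3 • P = 0} ≤ 3)
    (ψ : (ℓ : ℕ) → (ZMod ℓ)ˣ →* Multiplicative (ZMod (3 ^ 1)))
    (hψ : ∀ ℓ ∈ n.primeFactors, Function.Surjective (ψ ℓ))
    (hcert : kuriharaNumber D.f (3 ^ 1) n ψ ≠ 0)
    (hzero₁ : kuriharaNumber D.f (3 ^ 1) 1 ψ = 0)
    (ψ₂₇ : (ℓ : ℕ) → (ZMod ℓ)ˣ →* Multiplicative (ZMod (3 ^ 3)))
    (hunit₁ : kuriharaNumber D.f (3 ^ 3) 1 ψ₂₇ ≠ 0) :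
    BSDp W 3 :=
  bsdp_three_of_towerSurj_of_levelOneCertificates_of_baseRigidity_noRank hKatoS hDel hGZK hmod hmodD hKatoχ
    h26 hCT W hI hΔ hc₄ htower ht0 htam hN D hopt inv hperf hsum hcompl localEulerPoincareCharacteristic_rat
    v₃ hv₃ hPort n hn hcyc ψ hψ hcert hzero₁ ψ₂₇ hunit₁

/-- **END-m1 RECORD COROLLARY, [S24]-FREE, no `hr`, no `hEP` (potentially MULTIPLICATIVE rows).**
Exactly p03's `bsdp_three_potMult_of_levelOneCertificates_of_baseRigidity_noRank` with the binder `hEP`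
DELETED — hEP discharged by p300886 (`EPCTate.localEulerPoincareCharacteristic`, fed by name as
`localEulerPoincareCharacteristic_rat`); all other binders unchanged and in the same order.  CLOSES
NOTHING; the Kurihara values stay EVIDENCE hypotheses; nothing booked.
[cite: MilneADT2006, I §2 Thm 2.8 (p. 31)]
[cite: Kim2022StructureSelmer, §1.4.3 (PDF p. 7), Thm. 1.9 (6) and Thm. 3.13] [cite: Rubin2011, Thm. 2.8.4]
[cite: Delbourgo1998, Prop. 4 (p. 144)] [cite: AgasheRibetStein2006, Thm. 2.6 (p. 619)] -/
theorem bsdp_three_potMult_of_levelOneCertificates_of_baseRigidity_noRank_noEP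
    (hKatoS : Kato2004.rankZero_padicValNat_sha_le_sub_localTamagawa_of_additive_potGood_of_imageContainsSL2)
    (hDel : Delbourgo1998.prop4_rankZero_pow_dvd_constantCoeff)
    (hGZK : rank_eq_analyticRank_of_analyticRank_le_one) (hmod : hasEntireLFunction_rat)
    (hmodD : nonempty_modularParametrizationData)
    (hKatoχ : Wuthrich2014.kato_halfEigenCharIdeal_dvd_cyclotomicPrime_of_surjective)
    (h26 : cremona_abs_maninConstant_eq_one_of_level_le)
    (hCT : exists_casselsTate_pairing (K := ℚ))
    (W : WeierstrassCurve ℚ) [W.IsElliptic] [W.IsGloballyMinimal]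
    {E₀ : WeierstrassCurve ℤ} (hI : integralModelInt W = E₀)
    (hΔ : (3 : ℤ) ∣ E₀.Δ) (hc₄ : (3 : ℤ) ∣ E₀.c₄)
    (hsurj : W.HasSurjectiveModNGaloisRep ((3 : ℕ) : ℤ)) (hjneg : padicValRat 3 W.j < 0)
    (hc3 : ¬ 3 ∣ (W.baseChange ℚ_[3]).localTamagawaNumber ℤ_[3])
    (ht0 : Nat.card {Q : (W.baseChange ℚ_[3]).toAffine.Point // (3 : ℕ) • Q = 0} = 1)
    {N : ℕ} [NeZero N] (hN : N ≤ 130000) (D : ModularParametrizationData W N)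
    (hopt : ∀ z ∈ D.L.lattice, ∃ w ∈ periodLattice D.f, z = D.c * w)
    (inv : LocalInvariants ℚ 3) (hperf : inv.IsPerfect) (hsum : inv.SumLocalTermEqZero)
    (hcompl : inv.SelmerComplement)
    (v₃ : HeightOneSpectrum (𝓞 ℚ)) (hv₃ : ((3 : ℕ) : 𝓞 ℚ) ∈ v₃.asIdeal)
    (hPort : KatoKuriharaPortThreeAt W 0 v₃)
    (n : ℕ) [NeZero n] (hn : Kato.IsKolyvaginProduct W 3 1 n)
    (hcyc : ∀ (ℓ : ℕ) [Fact ℓ.Prime], ℓ ∣ n →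
      Nat.card {P : ((integralModelInt W).map (Int.castRingHom (ZMod ℓ))).toAffine.Point //
        3 • P = 0} ≤ 3)
    (ψ : (ℓ : ℕ) → (ZMod ℓ)ˣ →* Multiplicative (ZMod (3 ^ 1)))
    (hψ : ∀ ℓ ∈ n.primeFactors, Function.Surjective (ψ ℓ))
    (hcert : kuriharaNumber D.f (3 ^ 1) n ψ ≠ 0)
    (hzero₁ : kuriharaNumber D.f (3 ^ 1) 1 ψ = 0)
    (ψ₂₇ : (ℓ : ℕ) → (ZMod ℓ)ˣ →* Multiplicative (ZMod (3 ^ 3)))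
    (hunit₁ : kuriharaNumber D.f (3 ^ 3) 1 ψ₂₇ ≠ 0) :
    BSDp W 3 :=
  bsdp_three_potMult_of_levelOneCertificates_of_baseRigidity_noRank hKatoS hDel hGZK hmod hmodD hKatoχ h26
    hCT W hI hΔ hc₄ hsurj hjneg hc3 ht0 hN D hopt inv hperf hsum hcompl localEulerPoincareCharacteristic_rat
    v₃ hv₃ hPort n hn hcyc ψ hψ hcert hzero₁ ψ₂₇ hunit₁

/-- **END-m1 RECORD COROLLARY, NAMED-FACTS form, no `hr`, no `hEP` (potentially GOOD rows / tower form).**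
Exactly p03's `bsdp_three_of_towerSurj_of_levelOneCertificates_of_facts_noRank` (PT family as the named fact
`hPT : poitouTate_selmerStructure_duality ℚ`) with the binder `hEP` DELETED — hEP discharged by p300886
(`EPCTate.localEulerPoincareCharacteristic`, fed by name as `localEulerPoincareCharacteristic_rat`); all
other binders unchanged and in the same order.  On this form every non-certificate hypothesis of an END-m1
record is a NAMED FACT, the PORT, or one of the per-pair EVIDENCE binders {`D`/`hopt`, the three values}.
CLOSES NOTHING; nothing booked. [cite: MilneADT2006, I §2 Thm 2.8 (p. 31)]
[cite: Kim2022StructureSelmer, §1.4.3 (PDF p. 7), Thm. 1.9 (6) and Thm. 3.13] [cite: Rubin2011, Thm. 2.8.4]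
[cite: Kato2004Asterisque, Thm. 14.5 (3) (p. 236)] [cite: AgasheRibetStein2006, Thm. 2.6 (p. 619)] -/
theorem bsdp_three_of_towerSurj_of_levelOneCertificates_of_facts_noRank_noEP
    (hKatoS : Kato2004.rankZero_padicValNat_sha_le_sub_localTamagawa_of_additive_potGood_of_imageContainsSL2)
    (hDel : Delbourgo1998.prop4_rankZero_pow_dvd_constantCoeff)
    (hGZK : rank_eq_analyticRank_of_analyticRank_le_one) (hmod : hasEntireLFunction_rat)
    (hmodD : nonempty_modularParametrizationData)
    (hKatoχ : Wuthrich2014.kato_halfEigenCharIdeal_dvd_cyclotomicPrime_of_surjective)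
    (h26 : cremona_abs_maninConstant_eq_one_of_level_le)
    (hCT : exists_casselsTate_pairing (K := ℚ))
    (W : WeierstrassCurve ℚ) [W.IsElliptic] [W.IsGloballyMinimal]
    {E₀ : WeierstrassCurve ℤ} (hI : integralModelInt W = E₀)
    (hΔ : (3 : ℤ) ∣ E₀.Δ) (hc₄ : (3 : ℤ) ∣ E₀.c₄)
    (htower : ∀ m : ℕ, W.HasSurjectiveModNGaloisRep (3 ^ m : ℕ))
    (ht0 : Nat.card {Q : (W.baseChange ℚ_[3]).toAffine.Point // (3 : ℕ) • Q = 0} = 1)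
    (htam : ¬ 3 ∣ W.tamagawaProduct)
    {N : ℕ} [NeZero N] (hN : N ≤ 130000) (D : ModularParametrizationData W N)
    (hopt : ∀ z ∈ D.L.lattice, ∃ w ∈ periodLattice D.f, z = D.c * w)
    (hPT : poitouTate_selmerStructure_duality ℚ)
    (v₃ : HeightOneSpectrum (𝓞 ℚ)) (hv₃ : ((3 : ℕ) : 𝓞 ℚ) ∈ v₃.asIdeal)
    (hPort : KatoKuriharaPortThreeAt W 0 v₃)
    (n : ℕ) [NeZero n] (hn : Kato.IsKolyvaginProduct W 3 1 n)
    (hcyc : ∀ (ℓ : ℕ) [Fact ℓ.Prime], ℓ ∣ n →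
      Nat.card {P : ((integralModelInt W).map (Int.castRingHom (ZMod ℓ))).toAffine.Point //
        3 • P = 0} ≤ 3)
    (ψ : (ℓ : ℕ) → (ZMod ℓ)ˣ →* Multiplicative (ZMod (3 ^ 1)))
    (hψ : ∀ ℓ ∈ n.primeFactors, Function.Surjective (ψ ℓ))
    (hcert : kuriharaNumber D.f (3 ^ 1) n ψ ≠ 0)
    (hzero₁ : kuriharaNumber D.f (3 ^ 1) 1 ψ = 0)
    (ψ₂₇ : (ℓ : ℕ) → (ZMod ℓ)ˣ →* Multiplicative (ZMod (3 ^ 3)))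
    (hunit₁ : kuriharaNumber D.f (3 ^ 3) 1 ψ₂₇ ≠ 0) :
    BSDp W 3 :=
  bsdp_three_of_towerSurj_of_levelOneCertificates_of_facts_noRank hKatoS hDel hGZK hmod hmodD hKatoχ h26 hCT
    W hI hΔ hc₄ htower ht0 htam hN D hopt hPT localEulerPoincareCharacteristic_rat v₃ hv₃ hPort n hn hcyc ψ
    hψ hcert hzero₁ ψ₂₇ hunit₁

/-- **END-m1 RECORD COROLLARY, NAMED-FACTS form, no `hr`, no `hEP` (potentially MULTIPLICATIVE rows).**
Exactly p03's `bsdp_three_potMult_of_levelOneCertificates_of_facts_noRank` with the binder `hEP` DELETED —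
hEP discharged by p300886 (`EPCTate.localEulerPoincareCharacteristic`, fed by name as
`localEulerPoincareCharacteristic_rat`); all other binders unchanged and in the same order.  CLOSES NOTHING;
nothing booked. [cite: MilneADT2006, I §2 Thm 2.8 (p. 31)]
[cite: Kim2022StructureSelmer, §1.4.3 (PDF p. 7), Thm. 1.9 (6) and Thm. 3.13] [cite: Rubin2011, Thm. 2.8.4]
[cite: Delbourgo1998, Prop. 4 (p. 144)] [cite: AgasheRibetStein2006, Thm. 2.6 (p. 619)] -/
theorem bsdp_three_potMult_of_levelOneCertificates_of_facts_noRank_noEP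
    (hKatoS : Kato2004.rankZero_padicValNat_sha_le_sub_localTamagawa_of_additive_potGood_of_imageContainsSL2)
    (hDel : Delbourgo1998.prop4_rankZero_pow_dvd_constantCoeff)
    (hGZK : rank_eq_analyticRank_of_analyticRank_le_one) (hmod : hasEntireLFunction_rat)
    (hmodD : nonempty_modularParametrizationData)
    (hKatoχ : Wuthrich2014.kato_halfEigenCharIdeal_dvd_cyclotomicPrime_of_surjective)
    (h26 : cremona_abs_maninConstant_eq_one_of_level_le)
    (hCT : exists_casselsTate_pairing (K := ℚ))
    (W : WeierstrassCurve ℚ) [W.IsElliptic] [W.IsGloballyMinimal]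
    {E₀ : WeierstrassCurve ℤ} (hI : integralModelInt W = E₀)
    (hΔ : (3 : ℤ) ∣ E₀.Δ) (hc₄ : (3 : ℤ) ∣ E₀.c₄)
    (hsurj : W.HasSurjectiveModNGaloisRep ((3 : ℕ) : ℤ)) (hjneg : padicValRat 3 W.j < 0)
    (hc3 : ¬ 3 ∣ (W.baseChange ℚ_[3]).localTamagawaNumber ℤ_[3])
    (ht0 : Nat.card {Q : (W.baseChange ℚ_[3]).toAffine.Point // (3 : ℕ) • Q = 0} = 1)
    {N : ℕ} [NeZero N] (hN : N ≤ 130000) (D : ModularParametrizationData W N)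
    (hopt : ∀ z ∈ D.L.lattice, ∃ w ∈ periodLattice D.f, z = D.c * w)
    (hPT : poitouTate_selmerStructure_duality ℚ)
    (v₃ : HeightOneSpectrum (𝓞 ℚ)) (hv₃ : ((3 : ℕ) : 𝓞 ℚ) ∈ v₃.asIdeal)
    (hPort : KatoKuriharaPortThreeAt W 0 v₃)
    (n : ℕ) [NeZero n] (hn : Kato.IsKolyvaginProduct W 3 1 n)
    (hcyc : ∀ (ℓ : ℕ) [Fact ℓ.Prime], ℓ ∣ n →
      Nat.card {P : ((integralModelInt W).map (Int.castRingHom (ZMod ℓ))).toAffine.Point //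
        3 • P = 0} ≤ 3)
    (ψ : (ℓ : ℕ) → (ZMod ℓ)ˣ →* Multiplicative (ZMod (3 ^ 1)))
    (hψ : ∀ ℓ ∈ n.primeFactors, Function.Surjective (ψ ℓ))
    (hcert : kuriharaNumber D.f (3 ^ 1) n ψ ≠ 0)
    (hzero₁ : kuriharaNumber D.f (3 ^ 1) 1 ψ = 0)
    (ψ₂₇ : (ℓ : ℕ) → (ZMod ℓ)ˣ →* Multiplicative (ZMod (3 ^ 3)))
    (hunit₁ : kuriharaNumber D.f (3 ^ 3) 1 ψ₂₇ ≠ 0) :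
    BSDp W 3 :=
  bsdp_three_potMult_of_levelOneCertificates_of_facts_noRank hKatoS hDel hGZK hmod hmodD hKatoχ h26 hCT W hI
    hΔ hc₄ hsurj hjneg hc3 ht0 hN D hopt hPT localEulerPoincareCharacteristic_rat v₃ hv₃ hPort n hn hcyc ψ
    hψ hcert hzero₁ ψ₂₇ hunit₁

end Summit.BirchSwinnertonDyer.Rank1Residual.GaloisImage.Assembly

end
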